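import Literature.NumberTheory.Sieve.LargestPrimeFactorCubicIdeals
import HarnessLib

/-!
# Heath-Brown 2001, Lemma 4 (first part) and (3.5): the generators `α = a + b∛2 + c∛4`

Seventh proved layer of this seat under the named fact `HeathBrown2001_largestPrimeFactor_cubic`
(`LargestPrimeFactorCubic.lean`; D. R. Heath-Brown, *The largest prime factor of `X³ + 2`*, Proc.
London Math. Soc. (3) 82 (2001) 554–596).  The ideals `J = KL` of §2 are produced as principal
ideals `J = (α)`, `α = a + b∛2 + c∛4`, and §3 proves **Lemma 4** (p. 562):

> "Suppose `a, b, c` are integers, with `a` odd, and that `C = b² − ac` and `D = a² + bc` are both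
> coprime to `q = a³ − 2b³`. Write `α = a + b∛2 + c∛4` and `J = (α)`. Then `(q, α) = 1`. Moreover
> there is an integer `k` such that `n + ∛2 ∈ J` if and only if `n ≡ k (mod N(J))`. In particular we
> have `ρ(J) = 1`."

together with the congruence (3.5), `k_J/N(J) ≡ ab C̄/q + (2a²c + 4bc² − 4ab²)/(qN(J)) (mod 1)`,
which feeds the exponential sums `σ(n)` of the second part of the lemma.  This file PROVES the
first part and (3.5), following the printed proof (pp. 565–567) line by line, with
`A = a² − 2bc`, `B = 2c² − ab`, `E = 2a²c + 4bc² − 4ab²` and the norm form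
`N = N(α) = a³ + 2b³ + 4c³ − 6abc`:

* the four polynomial identities of §3: `4C²D = a²bN + (4ac² − 2b²c − a²b)q`, `q = aA − 2bC`,
  `aN = A² − 2BC`, and `C E = −abN − Bq` (`four_C_sq_D_eq`, `q_eq`, `a_mul_norm_eq`, `C_mul_E_eq`);
* (3.1)–(3.3): `(N, q) = 1`, `(A, C) = 1`, `(N, C) = 1` (`isCoprime_norm_q`, `isCoprime_A_C`,
  `isCoprime_norm_C`);
* "`C∛2 ≡ B (mod J)`" (`C_mul_θint_sub_B_mem`, witness `(b − c∛2)α = C∛2 − B`), `N ∈ J`, and hence,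
  for any inverse `u` of `C` modulo `N`, **`∛2 ≡ uB (mod J)`** (`θint_sub_mem_span`): `ρ(J) = 1`
  with the root `m = uB`, so that by Lemma 1 (`…Ideals`) `n + ∛2 ∈ J ↔ N ∣ n + uB ↔ N ∣ Cn + B`
  (`natCast_add_θint_mem_span_iff`, Heath-Brown's `k ≡ −BC̄`);
* **(3.5)** in divisibility form (`qN_dvd`): if `uC ≡ 1 (mod N)` and `wC ≡ 1 (mod q)` then
  `qN ∣ (−Bu)q − abwN − E`, i.e. `k/N − abw/q − E/(qN) ∈ ℤ` for `k = −Bu`;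
* `coordElt_mem_iff_dvd` — for any ideal `I ∋ ∛2 − j`: `a + b∛2 + c∛4 ∈ I ↔ N(I) ∣ a + bj + cj²`
  (the congruence "`c ≡ c₁(a, b, KA) (mod N(KA))`" of §4, p. 570).

Pure algebra in `ℤ` and `ℤ[∛2]`; the region `𝓡`, the set `𝒬` and the second (Fourier-analytic)
part of Lemma 4 are in later files.

## References

* D. R. Heath-Brown, *The largest prime factor of `X³ + 2`*, Proc. London Math. Soc. (3) 82 (2001)
  554–596: Lemma 4 (p. 562), §3 (pp. 565–567, (3.1)–(3.5)), §4 (p. 570).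
  [`HeathBrown2001LargestPrimeFactorCubic`]
* C. Hooley, *On the greatest prime factor of a cubic polynomial*, J. reine angew. Math. 303/304
  (1978) 21–50 (the correspondence, "essentially due to Hooley", p. 562). [`Hooley1978CubicPrimeFactor`]
-/

noncomputable section

open NumberField Finset

namespace Literature.NumberTheory.Sieve.LargestPrimeFactorCubic

open LFunctions.CubeRootTwoField CubicSieve

/-! ### The four identities of §3 -/

section Identities

variable (a b c : ℤ)

/-- `4C²D = a²b N(α) + (4ac² − 2b²c − a²b) q` (p. 565). [cite: HeathBrown2001LargestPrimeFactorCubic, §3 p. 565] -/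
theorem four_C_sq_D_eq :
    4 * (b ^ 2 - a * c) ^ 2 * (a ^ 2 + b * c) =
      a ^ 2 * b * (a ^ 3 + 2 * b ^ 3 + 4 * c ^ 3 - 6 * a * b * c) +
        (4 * a * c ^ 2 - 2 * b ^ 2 * c - a ^ 2 * b) * (a ^ 3 - 2 * b ^ 3) := by
  ring

/-- `q = aA − 2bC` (p. 565). [cite: HeathBrown2001LargestPrimeFactorCubic, §3 p. 565] -/
theorem q_eq : a ^ 3 - 2 * b ^ 3 = a * (a ^ 2 - 2 * b * c) - 2 * b * (b ^ 2 - a * c) := by ring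

/-- `a N(α) = A² − 2BC` (p. 565). [cite: HeathBrown2001LargestPrimeFactorCubic, §3 p. 565] -/
theorem a_mul_norm_eq :
    a * (a ^ 3 + 2 * b ^ 3 + 4 * c ^ 3 - 6 * a * b * c) =
      (a ^ 2 - 2 * b * c) ^ 2 - 2 * (2 * c ^ 2 - a * b) * (b ^ 2 - a * c) := by
  ring

/-- `C(2a²c + 4bc² − 4ab²) = −ab N(α) − Bq` (p. 566). [cite: HeathBrown2001LargestPrimeFactorCubic, §3 p. 566] -/
theorem C_mul_E_eq :
    (b ^ 2 - a * c) * (2 * a ^ 2 * c + 4 * b * c ^ 2 - 4 * a * b ^ 2) =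
      -(a * b * (a ^ 3 + 2 * b ^ 3 + 4 * c ^ 3 - 6 * a * b * c)) -
        (2 * c ^ 2 - a * b) * (a ^ 3 - 2 * b ^ 3) := by
  ring

end Identities

/-! ### (3.1)–(3.3): coprimality -/

section Coprime

variable {a b c : ℤ}

/-- **(3.1)** `(N(α), q) = 1`, from `(2CD, q) = 1` ("we have only to use the identity `4C²D = …` and
recall that `(2CD, q) = 1`"). [cite: HeathBrown2001LargestPrimeFactorCubic, §3 (3.1)] -/
theorem isCoprime_norm_q (h2 : IsCoprime (2 : ℤ) (a ^ 3 - 2 * b ^ 3))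
    (hC : IsCoprime (b ^ 2 - a * c) (a ^ 3 - 2 * b ^ 3))
    (hD : IsCoprime (a ^ 2 + b * c) (a ^ 3 - 2 * b ^ 3)) :
    IsCoprime (a ^ 3 + 2 * b ^ 3 + 4 * c ^ 3 - 6 * a * b * c) (a ^ 3 - 2 * b ^ 3) := by
  have h4 : IsCoprime (4 * (b ^ 2 - a * c) ^ 2 * (a ^ 2 + b * c)) (a ^ 3 - 2 * b ^ 3) := by
    have h22 : IsCoprime (4 : ℤ) (a ^ 3 - 2 * b ^ 3) := by
      rw [show (4 : ℤ) = 2 * 2 by norm_num]; exact h2.mul_left h2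
    exact (h22.mul_left (hC.pow_left (m := 2))).mul_left hD
  rw [four_C_sq_D_eq, IsCoprime.add_mul_right_left_iff] at h4
  exact h4.of_mul_left_right

/-- **(3.2)** `(A, C) = 1`, from `q = aA − 2bC` and `(C, q) = 1`.
[cite: HeathBrown2001LargestPrimeFactorCubic, §3 (3.2)] -/
theorem isCoprime_A_C (hC : IsCoprime (b ^ 2 - a * c) (a ^ 3 - 2 * b ^ 3)) :
    IsCoprime (a ^ 2 - 2 * b * c) (b ^ 2 - a * c) := by
  rw [q_eq a b c] at hC
  -- `IsCoprime C (a A + C (−2b))`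
  have h : IsCoprime (b ^ 2 - a * c) (a * (a ^ 2 - 2 * b * c) + (b ^ 2 - a * c) * (-2 * b)) := by
    have e : a * (a ^ 2 - 2 * b * c) + (b ^ 2 - a * c) * (-2 * b) =
        a * (a ^ 2 - 2 * b * c) - 2 * b * (b ^ 2 - a * c) := by ring
    rw [e]; exact hC
  rw [IsCoprime.add_mul_left_right_iff] at h
  exact h.of_mul_right_right.symm

/-- **(3.3)** `(N(α), C) = 1`, from `aN = A² − 2BC` and (3.2).
[cite: HeathBrown2001LargestPrimeFactorCubic, §3 (3.3)] -/
theorem isCoprime_norm_C (hC : IsCoprime (b ^ 2 - a * c) (a ^ 3 - 2 * b ^ 3)) :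
    IsCoprime (a ^ 3 + 2 * b ^ 3 + 4 * c ^ 3 - 6 * a * b * c) (b ^ 2 - a * c) := by
  have hA := isCoprime_A_C hC
  have h : IsCoprime ((a ^ 2 - 2 * b * c) ^ 2 + (b ^ 2 - a * c) * (-2 * (2 * c ^ 2 - a * b)))
      (b ^ 2 - a * c) := by
    rw [IsCoprime.add_mul_left_left_iff]
    exact hA.pow_left
  have e : (a ^ 2 - 2 * b * c) ^ 2 + (b ^ 2 - a * c) * (-2 * (2 * c ^ 2 - a * b)) =
      a * (a ^ 3 + 2 * b ^ 3 + 4 * c ^ 3 - 6 * a * b * c) := by ring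
  rw [e] at h
  exact h.of_mul_left_right

end Coprime

/-! ### `ρ((α)) = 1`: the root of `∛2` modulo `(α)` -/

section Root

variable (a b c : ℤ)

/-- `θ³ = 2` in `𝓞_K`. [folklore] -/
theorem θint_cube : (θint : 𝓞 K) ^ 3 = 2 := by
  apply RingOfIntegers.coe_injective
  simp [θ_pow_three, map_ofNat]

/-- **`C∛2 ≡ B (mod (α))`**: indeed `(b − c∛2) · α = C∛2 − B` ("on eliminating `∛4` we obtain
`C∛2 ≡ B (mod J)`", p. 566). [cite: HeathBrown2001LargestPrimeFactorCubic, §3 p. 566] -/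
theorem C_mul_θint_sub_B_mem :
    ((b ^ 2 - a * c : ℤ) : 𝓞 K) * θint - ((2 * c ^ 2 - a * b : ℤ) : 𝓞 K) ∈
      Ideal.span {coordElt (a, b, c)} := by
  rw [Ideal.mem_span_singleton]
  refine ⟨(b : 𝓞 K) - (c : 𝓞 K) * θint, ?_⟩
  have h3 := θint_cube
  simp only [coordElt]
  push_cast
  linear_combination ((c : 𝓞 K) ^ 2) * h3

/-- `N(α) ∈ (α)` (the norm of a generator lies in the ideal: `N((α)) = |N(α)|` and `N(I) ∈ I`).
[folklore] -/
theorem norm_mem_span :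
    ((a ^ 3 + 2 * b ^ 3 + 4 * c ^ 3 - 6 * a * b * c : ℤ) : 𝓞 K) ∈ Ideal.span {coordElt (a, b, c)} := by
  have h := Ideal.absNorm_mem (Ideal.span {coordElt (a, b, c)})
  rw [absNorm_span_coordElt] at h
  simp only at h
  rcases Int.natAbs_eq (a ^ 3 + 2 * b ^ 3 + 4 * c ^ 3 - 6 * a * b * c) with e | e
  · rw [e, Int.cast_natCast]; exact h
  · rw [e, Int.cast_neg, Int.cast_natCast]; exact (Ideal.neg_mem_iff _).2 h

variable {a b c}

/-- **`ρ((α)) = 1` with the root `uB`**: if `uC ≡ 1 (mod N(α))` then `∛2 ≡ uB (mod (α))`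
(`∛2 − uB = u(C∛2 − B) + tN∛2` with `1 − uC = tN`).  Heath-Brown: "Since `(C, J) = 1`, by (3.3),
we see that `ρ(J) = 1`". [cite: HeathBrown2001LargestPrimeFactorCubic, Lemma 4 and §3 p. 566] -/
theorem θint_sub_mem_span {u : ℤ}
    (hu : u * (b ^ 2 - a * c) ≡ 1 [ZMOD (a ^ 3 + 2 * b ^ 3 + 4 * c ^ 3 - 6 * a * b * c)]) :
    θint - ((u * (2 * c ^ 2 - a * b) : ℤ) : 𝓞 K) ∈ Ideal.span {coordElt (a, b, c)} := by
  obtain ⟨t, ht⟩ := (Int.ModEq.dvd hu : (a ^ 3 + 2 * b ^ 3 + 4 * c ^ 3 - 6 * a * b * c) ∣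
    1 - u * (b ^ 2 - a * c))
  have h1 := Ideal.mul_mem_left _ (u : 𝓞 K) (C_mul_θint_sub_B_mem a b c)
  have h2 := Ideal.mul_mem_left _ ((t : 𝓞 K) * θint) (norm_mem_span a b c)
  have e : θint - ((u * (2 * c ^ 2 - a * b) : ℤ) : 𝓞 K) =
      (u : 𝓞 K) * (((b ^ 2 - a * c : ℤ) : 𝓞 K) * θint - ((2 * c ^ 2 - a * b : ℤ) : 𝓞 K)) +
        (t : 𝓞 K) * θint * ((a ^ 3 + 2 * b ^ 3 + 4 * c ^ 3 - 6 * a * b * c : ℤ) : 𝓞 K) := by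
    have ht' : ((1 - u * (b ^ 2 - a * c) : ℤ) : 𝓞 K) =
        (((a ^ 3 + 2 * b ^ 3 + 4 * c ^ 3 - 6 * a * b * c) * t : ℤ) : 𝓞 K) := by rw [ht]
    push_cast at ht' ⊢
    linear_combination θint * ht'
  rw [e]
  exact Ideal.add_mem _ h1 h2

/-- Existence of the inverse: `(N(α), C) = 1` ((3.3)) gives `u` with `uC ≡ 1 (mod N(α))`.
[cite: HeathBrown2001LargestPrimeFactorCubic, §3 p. 566] -/
theorem exists_inverse_C (hC : IsCoprime (b ^ 2 - a * c) (a ^ 3 - 2 * b ^ 3)) :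
    ∃ u : ℤ, u * (b ^ 2 - a * c) ≡ 1 [ZMOD (a ^ 3 + 2 * b ^ 3 + 4 * c ^ 3 - 6 * a * b * c)] := by
  obtain ⟨u, t, hut⟩ := (isCoprime_norm_C hC).symm
  refine ⟨u, ?_⟩
  have : u * (b ^ 2 - a * c) = 1 + (a ^ 3 + 2 * b ^ 3 + 4 * c ^ 3 - 6 * a * b * c) * (-t) := by
    linear_combination hut
  rw [this]
  exact (Int.modEq_iff_dvd.2 ⟨t, by ring⟩ :
    1 + (a ^ 3 + 2 * b ^ 3 + 4 * c ^ 3 - 6 * a * b * c) * (-t) ≡ 1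
      [ZMOD (a ^ 3 + 2 * b ^ 3 + 4 * c ^ 3 - 6 * a * b * c)])

/-- **Lemma 4, first part** (`ρ(J) = 1`): under `(C, q) = 1` there is a rational integer `m` with
`∛2 ≡ m (mod (α))`. [cite: HeathBrown2001LargestPrimeFactorCubic, Lemma 4] -/
theorem exists_θint_sub_mem_span (hC : IsCoprime (b ^ 2 - a * c) (a ^ 3 - 2 * b ^ 3)) :
    ∃ m : ℤ, θint - (m : 𝓞 K) ∈ Ideal.span {coordElt (a, b, c)} := by
  obtain ⟨u, hu⟩ := exists_inverse_C hC
  exact ⟨_, θint_sub_mem_span hu⟩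

/-- **Lemma 4, the residue class**: with `uC ≡ 1 (mod N)` and `N = N(α) > 0`,
`n + ∛2 ∈ (α) ↔ N ∣ n + uB` — the `k` of Lemma 4 is `k ≡ −uB ≡ −BC̄ (mod N(α))`.
[cite: HeathBrown2001LargestPrimeFactorCubic, Lemma 4 and §3 p. 566] -/
theorem natCast_add_θint_mem_span_iff {u : ℤ}
    (hN : 0 < a ^ 3 + 2 * b ^ 3 + 4 * c ^ 3 - 6 * a * b * c)
    (hu : u * (b ^ 2 - a * c) ≡ 1 [ZMOD (a ^ 3 + 2 * b ^ 3 + 4 * c ^ 3 - 6 * a * b * c)]) (n : ℕ) :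
    (n : 𝓞 K) + θint ∈ Ideal.span {coordElt (a, b, c)} ↔
      (a ^ 3 + 2 * b ^ 3 + 4 * c ^ 3 - 6 * a * b * c) ∣ (n : ℤ) + u * (2 * c ^ 2 - a * b) := by
  rw [natCast_add_θint_mem_iff (θint_sub_mem_span hu) n, absNorm_span_coordElt]
  simp only
  rw [Int.natAbs_of_nonneg hN.le]

/-- The same class in Heath-Brown's form: `n + ∛2 ∈ (α) ↔ N(α) ∣ Cn + B` ("by Lemma 1 this last
condition is equivalent to `N(J) ∣ Cn + B`", p. 566). [cite: HeathBrown2001LargestPrimeFactorCubic, §3 p. 566] -/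
theorem natCast_add_θint_mem_span_iff' {u : ℤ}
    (hN : 0 < a ^ 3 + 2 * b ^ 3 + 4 * c ^ 3 - 6 * a * b * c)
    (hu : u * (b ^ 2 - a * c) ≡ 1 [ZMOD (a ^ 3 + 2 * b ^ 3 + 4 * c ^ 3 - 6 * a * b * c)]) (n : ℕ) :
    (n : 𝓞 K) + θint ∈ Ideal.span {coordElt (a, b, c)} ↔
      (a ^ 3 + 2 * b ^ 3 + 4 * c ^ 3 - 6 * a * b * c) ∣ (b ^ 2 - a * c) * n + (2 * c ^ 2 - a * b) := by
  rw [natCast_add_θint_mem_span_iff hN hu n]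
  set N := a ^ 3 + 2 * b ^ 3 + 4 * c ^ 3 - 6 * a * b * c with hNdef
  set C := b ^ 2 - a * c with hCdef
  set B := 2 * c ^ 2 - a * b with hBdef
  obtain ⟨t, ht⟩ := (Int.ModEq.dvd hu : N ∣ 1 - u * C)
  constructor
  · rintro ⟨k, hk⟩
    -- `C n + B = C (n + uB) + (1 − uC) B`
    exact ⟨C * k + t * B, by linear_combination C * hk + B * ht⟩
  · rintro ⟨k, hk⟩
    -- `n + uB = u (C n + B) + (1 − uC) n`
    exact ⟨u * k + t * n, by linear_combination u * hk + (n : ℤ) * ht⟩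

end Root

/-! ### (3.5): `k_J/N(J) ≡ ab C̄/q + E/(qN(J)) (mod 1)` -/

section ThreeFive

variable {a b c : ℤ}

/-- **(3.5)** in divisibility form: if `uC ≡ 1 (mod N)`, `wC ≡ 1 (mod q)` and `(N, q) = 1`
(`N = N(α)`, `q = a³ − 2b³`), then with `k = −Bu` and `E = 2a²c + 4bc² − 4ab²`,
`qN ∣ kq − abwN − E`, i.e. `k/N ≡ abw/q + E/(qN) (mod 1)` — proved as in print from
`CE = −abN − Bq` read modulo `q` and modulo `N`.
[cite: HeathBrown2001LargestPrimeFactorCubic, §3 (3.5), pp. 566–567] -/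
theorem qN_dvd {u w : ℤ}
    (hNq : IsCoprime (a ^ 3 + 2 * b ^ 3 + 4 * c ^ 3 - 6 * a * b * c) (a ^ 3 - 2 * b ^ 3))
    (hu : u * (b ^ 2 - a * c) ≡ 1 [ZMOD (a ^ 3 + 2 * b ^ 3 + 4 * c ^ 3 - 6 * a * b * c)])
    (hw : w * (b ^ 2 - a * c) ≡ 1 [ZMOD (a ^ 3 - 2 * b ^ 3)]) :
    (a ^ 3 - 2 * b ^ 3) * (a ^ 3 + 2 * b ^ 3 + 4 * c ^ 3 - 6 * a * b * c) ∣
      -((2 * c ^ 2 - a * b) * u) * (a ^ 3 - 2 * b ^ 3) -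
        a * b * w * (a ^ 3 + 2 * b ^ 3 + 4 * c ^ 3 - 6 * a * b * c) -
        (2 * a ^ 2 * c + 4 * b * c ^ 2 - 4 * a * b ^ 2) := by
  set N := a ^ 3 + 2 * b ^ 3 + 4 * c ^ 3 - 6 * a * b * c with hNdef
  set q := a ^ 3 - 2 * b ^ 3 with hqdef
  set C := b ^ 2 - a * c with hCdef
  set B := 2 * c ^ 2 - a * b with hBdef
  set E := 2 * a ^ 2 * c + 4 * b * c ^ 2 - 4 * a * b ^ 2 with hEdef
  have hCE : C * E = -(a * b * N) - B * q := by
    rw [hCdef, hEdef, hNdef, hBdef, hqdef]; exact C_mul_E_eq a b c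
  obtain ⟨t, ht⟩ := (Int.ModEq.dvd hu : N ∣ 1 - u * C)
  obtain ⟨s, hs⟩ := (Int.ModEq.dvd hw : q ∣ 1 - w * C)
  refine hNq.symm.mul_dvd ?_ ?_
  · -- modulo `q`: `E = wCE + (1 − wC)E = w(−abN − Bq) + qsE`
    exact ⟨-(B * u) + w * B - s * E, by linear_combination (-w) * hCE + (-E) * hs⟩
  · -- modulo `N`: `E = uCE + (1 − uC)E = u(−abN − Bq) + NtE`
    exact ⟨u * a * b - a * b * w - t * E, by linear_combination (-u) * hCE + (-E) * ht⟩

/-- Existence of the inverse of `C` modulo `q` from `(C, q) = 1`. [folklore] -/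
theorem exists_inverse_C_mod_q (hC : IsCoprime (b ^ 2 - a * c) (a ^ 3 - 2 * b ^ 3)) :
    ∃ w : ℤ, w * (b ^ 2 - a * c) ≡ 1 [ZMOD (a ^ 3 - 2 * b ^ 3)] := by
  obtain ⟨w, t, hwt⟩ := hC
  refine ⟨w, ?_⟩
  have : w * (b ^ 2 - a * c) = 1 + (a ^ 3 - 2 * b ^ 3) * (-t) := by linear_combination hwt
  rw [this]
  exact Int.modEq_iff_dvd.2 ⟨t, by ring⟩

end ThreeFive

/-! ### Membership of `α` in an ideal with a root: the congruence on `c` (§4) -/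

/-- For an ideal `I ∋ ∛2 − j`: `a + b∛2 + c∛4 ∈ I ↔ N(I) ∣ a + bj + cj²`
(`α − (a + bj + cj²) = (∛2 − j)(b + c(∛2 + j))`, then Lemma 1).  This is the congruence
"`KA ∣ a + b∛2 + c∛4` is therefore equivalent to … `c ≡ c₁(a, b, KA) (mod N(KA))`" of §4 (p. 570).
[cite: HeathBrown2001LargestPrimeFactorCubic, §4 p. 570] -/
theorem coordElt_mem_iff_dvd {I : Ideal (𝓞 K)} {j : ℤ} (hj : θint - (j : 𝓞 K) ∈ I) (a b c : ℤ) :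
    coordElt (a, b, c) ∈ I ↔ ((Ideal.absNorm I : ℕ) : ℤ) ∣ a + b * j + c * j ^ 2 := by
  rw [← intCast_mem_iff_absNorm_dvd hj]
  have e : coordElt (a, b, c) =
      ((a + b * j + c * j ^ 2 : ℤ) : 𝓞 K) + ((b : 𝓞 K) + (c : 𝓞 K) * (θint + j)) * (θint - j) := by
    simp only [coordElt]; push_cast; ring
  have hmem : ((b : 𝓞 K) + (c : 𝓞 K) * (θint + j)) * (θint - j) ∈ I := Ideal.mul_mem_left _ _ hj
  rw [e]
  refine ⟨fun h => ?_, fun h => Ideal.add_mem _ h hmem⟩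
  have h' := Ideal.sub_mem _ h hmem
  rwa [add_sub_cancel_right] at h'

end Literature.NumberTheory.Sieve.LargestPrimeFactorCubic
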